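import Mathlib

/-!
# Lemma Π (ROUTE.md Appendix A5) — the algebraic half, in abstract form

ROUTE.md §1 row S4ᴾ / §4 item 2 (closer C7) rests on **Lemma Π**: for a split-Weil corner
product `B` with `F`-compatible polarisation, the `F`-line of Weil classes `W = W_F(B)` is
algebraic as soon as ONE algebraic cycle `Y ⊂ B` of dimension `p` has `∫_Y w ≠ 0` for some
`w ∈ W ⊗ ℂ`.  The derivation (A5 (1)–(6)) mixes printed geometric inputs (Lieberman's algebraic
`Λ`, graphs of endomorphisms are algebraic correspondences, the Künneth/monomial structure of
`H^•(B)`, hom = num) with three pieces of pure linear algebra, which this file kernel-checks: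

* **A5 (1)** — the projector onto `W` along the other `F^×`-isotypic pieces is a `ℚ`-polynomial
  in one correspondence `T = a^*`, hence maps algebraic classes to algebraic classes
  (`isCompl_ker_aeval`, `projOf`, `projOf_mem_of_mem`).  Here the route's Aut(ℂ)-invariance
  argument is replaced by Bezout: `W = ker f(T)` and its complement `ker g(T)` for coprime
  `f, g ∈ ℚ[X]` with `(f g)(T) = 0` (`f` = the norm polynomial of `a^{2p}`, `g` = the product over
  the non-Weil characters; coprime because the characters are distinct).
* **A5 (2)** — "one non-zero Weil class suffices": `F` is generated over `ℚ` by the `k`-th powers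
  (`mem_adjoin_pow_succ`, by forward differences), so a `ℚ`-subspace of the `F`-line `W` that is
  stable under every `a^* = a^{k}·` is an `F`-subspace, hence `⊥` or `W`
  (`eq_top_of_stable_pow`).
* **A5 (5)** — the multiplicity bookkeeping "`M ⊔ N ⊔ {s^{2p}} = {t^{2p} : all t}`, `N`
  conjugation-symmetric, `|M| = 2p` ⇒ `M = {(cs)^{2p}}`" (`multiset_eq_of_symm`).
* **A5 (6)** — the assembly `weil_line_le_algebraic`: with a pairing `φ` that vanishes on the
  complement of `W` (the content of (5)) and is non-zero on one algebraic class, `W ≤ Alg`.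

Nothing here is specific to `p = 2` or to faces, exactly as the route says.  The converse
direction of Lemma Π (hom = num on abelian varieties) is a printed theorem and is not formalised.
-/

namespace HodgeRepro.LemmaPi

open Polynomial Finset
open scoped fwdDiff

/-! ## A5 (1): the projector is a polynomial in one correspondence -/

section Projector

variable {K : Type*} [Field K] {V : Type*} [AddCommGroup V] [Module K V]

/-- If `(f g)(T) = 0` then `(q g)(T)` lands in `ker f(T)` for every `q`. -/
theorem aeval_mul_mem_ker (T : Module.End K V) {f g : K[X]} (h : aeval T (f * g) = 0)
    (q : K[X]) (x : V) : aeval T (q * g) x ∈ LinearMap.ker (aeval T f) := by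
  rw [LinearMap.mem_ker, ← Module.End.mul_apply, ← map_mul]
  have hfq : f * (q * g) = q * (f * g) := by ring
  rw [hfq, map_mul, h, mul_zero, LinearMap.zero_apply]

/-- Bezout decomposition: for coprime `f, g` with `(f g)(T) = 0`,
`V = ker f(T) ⊕ ker g(T)`. -/
theorem isCompl_ker_aeval (T : Module.End K V) {f g : K[X]} (hfg : IsCoprime f g)
    (h : aeval T (f * g) = 0) :
    IsCompl (LinearMap.ker (aeval T f)) (LinearMap.ker (aeval T g)) := by
  obtain ⟨u, v, huv⟩ := hfg
  have key : ∀ x : V, aeval T (v * g) x + aeval T (u * f) x = x := by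
    intro x
    rw [← LinearMap.add_apply, ← map_add, add_comm, huv, map_one, Module.End.one_apply]
  refine ⟨?_, ?_⟩
  · rw [Submodule.disjoint_def]
    intro x hx hy
    rw [LinearMap.mem_ker] at hx hy
    have hx' := key x
    rw [map_mul, Module.End.mul_apply, hy, map_zero, map_mul, Module.End.mul_apply, hx,
      map_zero, add_zero] at hx'
    exact hx'.symm
  · rw [codisjoint_iff, eq_top_iff]
    intro x _
    rw [← key x]
    refine Submodule.add_mem_sup (aeval_mul_mem_ker T h v x) ?_
    have h' : aeval T (g * f) = 0 := by rwa [mul_comm]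
    exact aeval_mul_mem_ker T h' u x

/-- The projector onto `ker f(T)` along `ker g(T)`: the polynomial `v g` in `T`, where
`u f + v g = 1` is a Bezout identity (chosen by `Classical.choose`). -/
noncomputable def projOf (T : Module.End K V) {f g : K[X]} (hfg : IsCoprime f g) :
    Module.End K V :=
  aeval T (Classical.choose (Classical.choose_spec hfg) * g)

/-- `projOf` is of the form `aeval T q` for a polynomial `q`. -/
theorem projOf_eq_aeval (T : Module.End K V) {f g : K[X]} (hfg : IsCoprime f g) :
    ∃ q : K[X], projOf T hfg = aeval T q :=
  ⟨_, rfl⟩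

/-- `projOf` lands in `ker f(T)`. -/
theorem projOf_mem_ker (T : Module.End K V) {f g : K[X]} (hfg : IsCoprime f g)
    (h : aeval T (f * g) = 0) (x : V) : projOf T hfg x ∈ LinearMap.ker (aeval T f) :=
  aeval_mul_mem_ker T h _ x

/-- `projOf` is the identity on `ker f(T)`. -/
theorem projOf_apply_of_mem_ker (T : Module.End K V) {f g : K[X]} (hfg : IsCoprime f g)
    {x : V} (hx : x ∈ LinearMap.ker (aeval T f)) : projOf T hfg x = x := by
  unfold projOf
  set u := Classical.choose hfg with hu
  set v := Classical.choose (Classical.choose_spec hfg) with hv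
  have huv : u * f + v * g = 1 := Classical.choose_spec (Classical.choose_spec hfg)
  have key : aeval T (v * g) x + aeval T (u * f) x = x := by
    rw [← LinearMap.add_apply, ← map_add, add_comm, huv, map_one, Module.End.one_apply]
  rw [LinearMap.mem_ker] at hx
  have h0 : aeval T (u * f) x = 0 := by rw [map_mul, Module.End.mul_apply, hx, map_zero]
  rw [h0, add_zero] at key
  exact key

/-- `projOf` kills `ker g(T)`. -/
theorem projOf_apply_of_mem_ker_right (T : Module.End K V) {f g : K[X]} (hfg : IsCoprime f g)
    {x : V} (hx : x ∈ LinearMap.ker (aeval T g)) : projOf T hfg x = 0 := by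
  unfold projOf
  rw [LinearMap.mem_ker] at hx
  rw [map_mul, Module.End.mul_apply, hx, map_zero]

/-- Powers of `T` preserve a `T`-stable subspace. -/
theorem pow_apply_mem (T : Module.End K V) (A : Submodule K V) (hA : ∀ x ∈ A, T x ∈ A)
    (n : ℕ) {x : V} (hx : x ∈ A) : (T ^ n) x ∈ A := by
  induction n with
  | zero => simpa using hx
  | succ n ih => rw [pow_succ', Module.End.mul_apply]; exact hA _ ih

/-- Polynomials in `T` preserve a `T`-stable subspace. -/
theorem aeval_apply_mem (T : Module.End K V) (A : Submodule K V) (hA : ∀ x ∈ A, T x ∈ A)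
    (q : K[X]) {x : V} (hx : x ∈ A) : aeval T q x ∈ A := by
  induction q using Polynomial.induction_on' with
  | add p q hp hq => rw [map_add, LinearMap.add_apply]; exact A.add_mem hp hq
  | monomial n c =>
    rw [aeval_monomial, Module.End.mul_apply, Module.algebraMap_end_apply]
    exact A.smul_mem _ (pow_apply_mem T A hA n hx)

/-- **A5 (1).** A `T`-stable subspace `Alg` (the algebraic classes, stable under the
correspondence `a^*`) is mapped by the projector into `Alg ⊓ ker f(T)`: the projection of an
algebraic class onto the Weil line is algebraic. -/
theorem projOf_mem_of_mem (T : Module.End K V) (Alg : Submodule K V)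
    (hAlg : ∀ x ∈ Alg, T x ∈ Alg) {f g : K[X]} (hfg : IsCoprime f g)
    (h : aeval T (f * g) = 0) {u : V} (hu : u ∈ Alg) :
    projOf T hfg u ∈ Alg ⊓ LinearMap.ker (aeval T f) :=
  ⟨aeval_apply_mem T Alg hAlg _ hu, projOf_mem_ker T hfg h u⟩

/-- Every vector splits as its projection plus a vector of `ker g(T)`. -/
theorem sub_projOf_mem_ker (T : Module.End K V) {f g : K[X]} (hfg : IsCoprime f g)
    (h : aeval T (f * g) = 0) (x : V) : x - projOf T hfg x ∈ LinearMap.ker (aeval T g) := by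
  unfold projOf
  set u := Classical.choose hfg with hu
  set v := Classical.choose (Classical.choose_spec hfg) with hv
  have huv : u * f + v * g = 1 := Classical.choose_spec (Classical.choose_spec hfg)
  have key : aeval T (v * g) x + aeval T (u * f) x = x := by
    rw [← LinearMap.add_apply, ← map_add, add_comm, huv, map_one, Module.End.one_apply]
  have hx : x - aeval T (v * g) x = aeval T (u * f) x := (eq_sub_of_add_eq' key).symm
  rw [hx]
  have h' : aeval T (g * f) = 0 := by rwa [mul_comm]
  exact aeval_mul_mem_ker T h' u x

end Projector

/-! ## A5 (2): a ℚ-algebra is generated by its `(n+1)`-st powers; the Weil line is simple -/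

/-- The value at `0` of the `n`-th forward difference of `r ↦ (r + θ)^(n+1)` is
`θ (n+1) n! + (Δ^n (r ↦ r^(n+1))) 0`: expand by the binomial theorem, the terms `r^j`, `j < n`,
are killed by `Δ^n`, the term `r^n` contributes `n!`. -/
theorem fwdDiff_iter_shift_pow_succ_zero {A : Type*} [CommRing A] (n : ℕ) (θ : A) :
    ((Δ_[1])^[n] fun r : A => (r + θ) ^ (n + 1)) 0 =
      θ * (n + 1) * (n.factorial : A) + ((Δ_[1])^[n] fun r : A => r ^ (n + 1)) 0 := by
  have hexp : (fun r : A => (r + θ) ^ (n + 1)) =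
      ∑ j ∈ range (n + 2), (θ ^ (n + 1 - j) * ((n + 1).choose j : A)) • fun r : A => r ^ j := by
    ext r
    rw [add_pow, Finset.sum_apply]
    refine sum_congr rfl fun j _ => ?_
    rw [Pi.smul_apply, smul_eq_mul]
    ring
  rw [hexp, fwdDiff_iter_finsetSum, Finset.sum_apply, sum_range_succ, sum_range_succ,
    sum_eq_zero (fun j hj => ?_)]
  · rw [zero_add, fwdDiff_iter_const_smul, fwdDiff_iter_const_smul, Pi.smul_apply, Pi.smul_apply,
      smul_eq_mul, smul_eq_mul, fwdDiff_iter_eq_factorial, Pi.natCast_apply]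
    simp only [Nat.add_sub_cancel_left, pow_one, Nat.choose_succ_self_right, Nat.sub_self,
      pow_zero, Nat.choose_self, Nat.cast_one, mul_one, one_mul]
    push_cast
    ring
  · rw [fwdDiff_iter_const_smul, Pi.smul_apply,
      fwdDiff_iter_pow_eq_zero_of_lt (mem_range.mp hj), Pi.zero_apply, smul_zero]

/-- **A5 (2), the field-theoretic input.** Every element of a commutative `ℚ`-algebra lies in the
`ℚ`-subalgebra generated by the `(n+1)`-st powers: `θ (n+1) n!` is a `ℤ`-combination of the
powers `(θ + i)^(n+1)`, `0 ≤ i ≤ n` (the `n`-th forward difference), up to a `ℤ`-combination of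
the powers `i^(n+1)`. (ROUTE.md A5 (2): "`F` is generated over `ℚ` by the `2p`-th powers
`(θ + n)^{2p}`".) -/
theorem mem_adjoin_pow_succ {A : Type*} [CommRing A] [Algebra ℚ A] (n : ℕ) (θ : A) :
    θ ∈ Algebra.adjoin ℚ (Set.range fun x : A => x ^ (n + 1)) := by
  set S := Algebra.adjoin ℚ (Set.range fun x : A => x ^ (n + 1)) with hS
  have hpow : ∀ x : A, x ^ (n + 1) ∈ S := fun x => Algebra.subset_adjoin ⟨x, rfl⟩
  have h1 : ((Δ_[1])^[n] fun r : A => (r + θ) ^ (n + 1)) 0 ∈ S := by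
    rw [fwdDiff_iter_eq_sum_shift]
    exact S.sum_mem fun i _ => S.zsmul_mem (hpow _) _
  have h3 : ((Δ_[1])^[n] fun r : A => r ^ (n + 1)) 0 ∈ S := by
    rw [fwdDiff_iter_eq_sum_shift]
    exact S.sum_mem fun i _ => S.zsmul_mem (hpow _) _
  have h4 : θ * (n + 1) * (n.factorial : A) ∈ S := by
    have := S.sub_mem h1 h3
    rwa [fwdDiff_iter_shift_pow_succ_zero, add_sub_cancel_right] at this
  set c : ℚ := (n + 1 : ℚ) * (n.factorial : ℚ) with hc
  have hq : c ≠ 0 := by positivity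
  have hcast : θ * (n + 1) * (n.factorial : A) = θ * algebraMap ℚ A c := by
    rw [hc, map_mul, map_add, map_natCast, map_one, map_natCast]
    ring
  have hθ : θ = c⁻¹ • (θ * (n + 1) * (n.factorial : A)) := by
    rw [hcast, Algebra.smul_def]
    symm
    calc algebraMap ℚ A c⁻¹ * (θ * algebraMap ℚ A c)
        = θ * (algebraMap ℚ A c⁻¹ * algebraMap ℚ A c) := by ring
      _ = θ := by rw [← map_mul, inv_mul_cancel₀ hq, map_one, mul_one]
  rw [hθ]
  exact S.smul_mem h4 _

section Line

variable {F : Type*} [Field F] [CharZero F]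
variable {W : Type*} [AddCommGroup W] [Module ℚ W] [Module F W] [IsScalarTower ℚ F W]

/-- A `ℚ`-subspace of an `F`-module stable under multiplication by every `(n+1)`-st power of `F`
is stable under all of `F` (the `(n+1)`-st powers generate `F` over `ℚ`). -/
theorem smul_mem_of_stable_pow (n : ℕ) (A : Submodule ℚ W)
    (hA : ∀ a : F, ∀ x ∈ A, (a ^ (n + 1)) • x ∈ A) (b : F) {x : W} (hx : x ∈ A) :
    b • x ∈ A := by
  have hb : b ∈ Algebra.adjoin ℚ (Set.range fun x : F => x ^ (n + 1)) :=
    mem_adjoin_pow_succ n b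
  induction hb using Algebra.adjoin_induction generalizing x with
  | mem y hy => obtain ⟨a, rfl⟩ := hy; exact hA a x hx
  | algebraMap c => rw [algebraMap_smul]; exact A.smul_mem c hx
  | add y z _ _ hy hz => rw [add_smul]; exact A.add_mem (hy hx) (hz hx)
  | mul y z _ _ hy hz => rw [mul_smul]; exact hy (hz hx)

/-- The `F`-submodule of `W` with the same carrier as a `ℚ`-subspace stable under all
`(n+1)`-st powers. -/
def toSubmoduleF (n : ℕ) (A : Submodule ℚ W)
    (hA : ∀ a : F, ∀ x ∈ A, (a ^ (n + 1)) • x ∈ A) : Submodule F W where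
  carrier := A
  add_mem' := A.add_mem
  zero_mem' := A.zero_mem
  smul_mem' := fun b _ hx => smul_mem_of_stable_pow n A hA b hx

/-- **A5 (2).** In a 1-dimensional `F`-space (the Weil line `W_F(B)`), a non-zero `ℚ`-subspace
stable under every `a^{n+1}·`, `a ∈ F` (the action of the correspondences `a^*` on the line) is
the whole line: "one non-zero Weil class suffices". -/
theorem eq_top_of_stable_pow (hW : Module.finrank F W = 1) (n : ℕ) (A : Submodule ℚ W)
    (hA : ∀ a : F, ∀ x ∈ A, (a ^ (n + 1)) • x ∈ A) (hne : A ≠ ⊥) : A = ⊤ := by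
  obtain ⟨w, hwA, hw0⟩ := Submodule.exists_mem_ne_zero_of_ne_bot hne
  rw [finrank_eq_one_iff_of_nonzero' w hw0] at hW
  rw [eq_top_iff]
  intro x _
  obtain ⟨c, rfl⟩ := hW x
  exact smul_mem_of_stable_pow n A hA c hwA

end Line

/-! ## A5 (5): the multiplicity bookkeeping -/

section Multiset

variable {ι : Type*} [DecidableEq ι]

/-- **A5 (5).** Multisets of embeddings: if `M + N + 2p·{s}` is the full multiset in which every
`t` occurs exactly `2p` times (the top class `⊗_t ∧^{2p} H¹(B)_t`), `N` is conjugation-symmetric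
(`count (c t) N = count t N`, the monomials of the `F`-compatible polarisation), `c s ≠ s`, and
`|M| = 2p`, then `M = 2p·{c s}`: the only component of an algebraic class that pairs with
`θ^{d-2p} ∪ w_s` is its `W_{cs}`-component. -/
theorem multiset_eq_of_symm (c : ι → ι) (p : ℕ) (s : ι) (hcs : c s ≠ s)
    (M N full : Multiset ι) (hfull : ∀ t, full.count t = 2 * p)
    (hM : Multiset.card M = 2 * p) (hN : ∀ t, N.count (c t) = N.count t)
    (h : M + N + (2 * p) • ({s} : Multiset ι) = full) :
    M = (2 * p) • ({c s} : Multiset ι) := by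
  have hs := congrArg (Multiset.count s) h
  rw [Multiset.count_add, Multiset.count_add, Multiset.count_nsmul, Multiset.count_singleton_self,
    hfull, mul_one] at hs
  have hMs : M.count s = 0 := by omega
  have hNs : N.count s = 0 := by omega
  have hcs' := congrArg (Multiset.count (c s)) h
  rw [Multiset.count_add, Multiset.count_add, Multiset.count_nsmul, Multiset.count_singleton,
    if_neg hcs, hfull, hN, hNs] at hcs'
  have hMcs : M.count (c s) = 2 * p := by omega
  rw [Multiset.nsmul_singleton, Multiset.eq_replicate]
  refine ⟨hM, fun b hb => ?_⟩
  have hall : ∀ x ∈ M, c s = x := Multiset.count_eq_card.mp (by rw [hMcs, hM])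
  exact (hall b hb).symm

end Multiset


/-! ## A5 (6): the assembly -/

section Assembly

variable {V : Type*} [AddCommGroup V] [Module ℚ V]
variable {F : Type*} [Field F] [CharZero F]
variable {Wm : Type*} [AddCommGroup Wm] [Module ℚ Wm] [Module F Wm] [IsScalarTower ℚ F Wm]
variable {E : Type*} [AddCommGroup E] [Module ℚ E]

/-- **Lemma Π, the algebraic half (ROUTE.md A5 (6)), abstract form.**
Data: `V` = `H^{2p}(B, ℚ)`; `Alg ≤ V` the algebraic classes; `T : F → End V`, `T a = a^*`, each
preserving `Alg` (graphs of endomorphisms are algebraic correspondences, M2 Cor 5.6);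
`a₀ ∈ F` with coprime `f, g ∈ ℚ[X]`, `(f g)(T a₀) = 0`, so that `W := ker f(T a₀)` is the Weil
line and `ker g(T a₀)` its complement (distinct characters, A5 (1)); the Weil line is the image
of a 1-dimensional `F`-space `Wm` under an injective `ℚ`-linear `ι` on which every `a^*` acts as
`a^{n+1}` (`n + 1 = 2p`; A5 (2)); a pairing `φ : V →ₗ[ℚ] E` (`x ↦ ∫ x ∪ θ^{d-2p} ∪ w`, `E = ℂ`)
vanishing on the complement (the content of A5 (5)); and one algebraic class `u` with
`φ u ≠ 0` (`u` = the `H^{2p}`-part of `[Y]` under Lieberman's `Λ`, A5 (3)).  Then `W ≤ Alg`: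
the whole Weil line is algebraic. -/
theorem weil_line_le_algebraic (T : F → Module.End ℚ V) (Alg : Submodule ℚ V)
    (hAlg : ∀ a, ∀ x ∈ Alg, T a x ∈ Alg) (a₀ : F) {f g : ℚ[X]} (hfg : IsCoprime f g)
    (h0 : aeval (T a₀) (f * g) = 0)
    (n : ℕ) (ι : Wm →ₗ[ℚ] V) (hW : Module.finrank F Wm = 1)
    (hrange : LinearMap.range ι = LinearMap.ker (aeval (T a₀) f))
    (hT : ∀ a : F, ∀ w : Wm, T a (ι w) = ι ((a ^ (n + 1)) • w))
    (φ : V →ₗ[ℚ] E) (hφ : ∀ x ∈ LinearMap.ker (aeval (T a₀) g), φ x = 0)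
    (u : V) (hu : u ∈ Alg) (hne : φ u ≠ 0) :
    LinearMap.ker (aeval (T a₀) f) ≤ Alg := by
  -- the projection `e u` of `u` onto the Weil line is algebraic and non-zero
  set e := projOf (T a₀) hfg with he
  have heu : e u ∈ Alg ⊓ LinearMap.ker (aeval (T a₀) f) :=
    projOf_mem_of_mem (T a₀) Alg (hAlg a₀) hfg h0 hu
  have hne' : e u ≠ 0 := by
    intro h
    apply hne
    have hsplit : φ u = φ (e u) + φ (u - e u) := by
      rw [← map_add]; congr 1; abel
    have hrest : φ (u - e u) = 0 := hφ _ (sub_projOf_mem_ker (T a₀) hfg h0 u)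
    rw [hsplit, hrest, h, map_zero, zero_add]
  -- pull `Alg` back to the `F`-line `Wm`: a `ℚ`-subspace stable under all `a^{n+1}·`, non-zero
  set A : Submodule ℚ Wm := Alg.comap ι with hA
  have hAst : ∀ a : F, ∀ w ∈ A, (a ^ (n + 1)) • w ∈ A := by
    intro a w hw
    rw [hA, Submodule.mem_comap] at hw ⊢
    rw [← hT]
    exact hAlg a _ hw
  have hAne : A ≠ ⊥ := by
    obtain ⟨w, hw⟩ : e u ∈ LinearMap.range ι := by rw [hrange]; exact heu.2
    intro hbot
    have hwA : w ∈ A := by rw [hA, Submodule.mem_comap, hw]; exact heu.1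
    rw [hbot, Submodule.mem_bot] at hwA
    apply hne'
    rw [← hw, hwA, map_zero]
  have hAtop : A = ⊤ := eq_top_of_stable_pow hW n A hAst hAne
  -- hence every element of the Weil line is algebraic
  intro x hx
  rw [← hrange] at hx
  obtain ⟨w, rfl⟩ := hx
  have hw : w ∈ A := by rw [hAtop]; exact Submodule.mem_top
  rwa [hA, Submodule.mem_comap] at hw

end Assembly

end HodgeRepro.LemmaPi
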